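import Summits.Ventures.CertifiedArithmetic.LowPrec.GemmThetaE3M2Defs

/-!
# The θ-certificate of E3M2²→bfloat16: kernel check of the states with index in `[1056, 1152)`

HONEST FRAMING (venture CertifiedArithmetic / cell `pub-lowprec`, seat gemm, gen 7): certified error
envelopes and provably optimal rounding/accumulation schemes for low-precision formats under stated
cost models; every table by two implementations; no hardware or vendor claims.

Part 12 of 27 of the kernel check of the Boolean certificate of `GemmThetaE3M2Defs.lean`
(paper `gemm.tex` §Regimes Prop. Θ(i), configuration E3M2·E3M2 → `bfloat16`, sequential, RNE): every
edge from the states with index `1056 ≤ i < 1152` (both signs, all 291 letters, with the pair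
checks after free moves) passes `edgeOK`, by `decide +kernel` in chunks of 24 indices (each chunk
≈ 13,968 edges).  Split into files only to keep each file's kernel time near three minutes;
`GemmThetaE3M2.lean` assembles the parts.  See the Defs file for the meaning of the check.
-/

namespace Literature.ComputerArithmetic.FloatingPoint

namespace MiniFloat

namespace ThetaE3M2

/-- Every edge from the states with index in `[1056, 1080)` (both signs, all 291 letters) passes
`edgeOK`. [cell certificate, kernel-checked] -/
theorem edges_ok_1056 : rowsOK 1056 24 = true := by
  decide +kernel

/-- Every edge from the states with index in `[1080, 1104)` (both signs, all 291 letters) passes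
`edgeOK`. [cell certificate, kernel-checked] -/
theorem edges_ok_1080 : rowsOK 1080 24 = true := by
  decide +kernel

/-- Every edge from the states with index in `[1104, 1128)` (both signs, all 291 letters) passes
`edgeOK`. [cell certificate, kernel-checked] -/
theorem edges_ok_1104 : rowsOK 1104 24 = true := by
  decide +kernel

/-- Every edge from the states with index in `[1128, 1152)` (both signs, all 291 letters) passes
`edgeOK`. [cell certificate, kernel-checked] -/
theorem edges_ok_1128 : rowsOK 1128 24 = true := by
  decide +kernel

/-- PART 12: every edge from the states with index in `[1056, 1152)` passes `edgeOK`.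
[cell certificate, kernel-checked] -/
theorem part_12 : rowsOK 1056 96 = true :=
  rowsOK_append (l₁ := 24) (l₂ := 72) edges_ok_1056 <|
  rowsOK_append (l₁ := 24) (l₂ := 48) edges_ok_1080 <|
  rowsOK_append (l₁ := 24) (l₂ := 24) edges_ok_1104 <|
  edges_ok_1128

end ThetaE3M2

end MiniFloat

end Literature.ComputerArithmetic.FloatingPoint
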